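import Summits.QuantumFields.YangMills.Theorems.ColdStartUniversalityLatticeLangevinLipschitzExtensionII
import Summits.QuantumFields.YangMills.Theorems.ColdStartUniversalityLatticeLangevinRiemannLocalToGlobal
import Mathlib.Analysis.Calculus.BumpFunction.SmoothApprox
import HarnessLib

/-!
# Shen–Zhu–Zhu's Theorem 4.2 (4.5) in `W₁` form FOR EVERY `ρ_L`-LIPSCHITZ OBSERVABLE, uniformly in the volume:
# `|P_t F(Q) − P_t F(Q')| ≤ e^(−(1−12|β'|)t)·Lip_(ρ_L)(F)·ρ_L(Q,Q')` for all `F : SU(2)^E → ℝ`, `|β'| < 1/12`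

Seat `ym-line-csu-p1` (g41), route `ColdStartUniversality` of `Summits/QuantumFields/YangMills`, helper file G54 (`--supports stmt-QuantumFields-24809`).
G44 (`…RiemannLipschitzContraction`) proved the contraction of the `ρ_L`-Lipschitz seminorm under the `SU(2)` lattice Langevin semigroup for `C⁵`
CYLINDER observables `f∘coords`.  This file removes the smoothness restriction: every `L_F`-Lipschitz `F : (SU(2)^E, ρ_L) → ℝ` obeys the same bound.
The proof mollifies the quaternionic-retraction extension `F̃ = χ·(F∘π)` of parts I/II (G52, G53) on the coordinate space `X = ℝ^(E×2×2×2)` with a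
normed bump `φ_r` (`Mathlib.Analysis.Calculus.BumpFunction`): `g_r = φ_r ⋆ F̃` is `C^∞`, `|g_r∘coords − F| ≤ 12·L_F·√#E·r` (modulus of `F̃`, G53), and
`g_r∘coords` is `L_F/(1 − 2r)`-Lipschitz for `ρ_L` — locally, because a common shift `t` of the coordinates dilates `ρ_L` through `π` by at most
`1/(1−2r)` up to the arc/chord factor (G53), and globally by the geodesic local-to-global principle (G51); then G44 applies to `g_r` and `r → 0`.

* ★★ `ext_shift_sub_le`, `ext_shift_uniformLocalLipschitz` — `|F̃(coords Q' − t) − F̃(coords Q − t)| ≤ (L_F/(1−2r) + η)·ρ_L(Q,Q')` for `ρ_L(Q,Q') < δ(η)`,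
  uniformly in `‖t‖_∞ ≤ r ≤ 1/4`;
* ★ `normed_convolution_sub_le` — `|(φ ⋆ u)(x) − (φ ⋆ u)(x')| ≤ B` if `|u(x − s) − u(x' − s)| ≤ B` on the support ball of the normed bump `φ`;
* ★★ `wilson_riemannLipschitz_contraction_mollified` — the bound with the mollification error: `e^(−ct)·(L_F/(1−2r))·ρ_L + 24·L_F·√#E·r`, `0 < r ≤ 1/4`;
* ★★★ `wilson_riemannLipschitz_contraction_allLipschitz` — **for `|β'| < 1/12`, every `L`, every realising kernel family `κ`, every `t ≥ 0`, all
  `Q, Q'` and EVERY `F` with `|F(Q') − F(Q)| ≤ L_F·ρ_L(Q,Q')`:  `|∫F dκ_t(Q) − ∫F dκ_t(Q')| ≤ e^(−(1−12|β'|)t)·L_F·ρ_L(Q,Q')`** — i.e.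
  `W₁,ρ_L(κ_t(Q,·), κ_t(Q',·)) ≤ e^(−(1−12|β'|)t)·ρ_L(Q,Q')` by Kantorovich–Rubinstein duality: Shen–Zhu–Zhu's (4.5) with `W₂` replaced by `W₁`, rate
  `1 − 12|β'| ≥ K_𝒮 = 1 − 16|β'|` (`N = 2`, `d = 4` in (1.6)), kernel-checked and uniform in the volume.

THEOREMS ONLY, no definition, no sorry.  HONEST FRAMING: this is the `W₁` shadow of SZZ Theorem 4.2 for `SU(2)`; the `W₂` statement (tree fact
`shenZhuZhu_finiteVolumeErgodicity`) is NOT discharged here; nothing about the route's scaling window; `UniformColdStartMixing` (24809, ASIDE) is not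
restated; no crux, rung or summit statement is proved; the Yang–Mills mass gap is NOT proved.
-/

set_option autoImplicit false

noncomputable section

namespace Summit.QuantumFields.YangMills.Theorems.ColdStartUniversality

open MeasureTheory ProbabilityTheory Matrix Complex Finset Filter Topology Set Metric
open scoped ComplexConjugate BigOperators Real NNReal Convolution
open Literature.MathematicalPhysics.QuantumFieldTheory
open Literature.MathematicalPhysics.QuantumLattice (fundamentalRep fundamentalLatticeRep continuous_fundamentalRep fundamentalRep_apply fundamentalLatticeRep_N)

variable {L : ℕ} [NeZero L]

/-! ## §1. The extension is uniformly locally `(L_F/(1−2r) + η)`-Lipschitz along common shifts -/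

/-- ★★ For `‖t‖_∞ ≤ r ≤ 1/4`, `u < 1` and `(1/(1−2r))²·ρ_L(Q,Q')² ≤ 8u`:
`|F̃(coords Q' − t) − F̃(coords Q − t)| ≤ L_F·((1/(1−2r))/√(1−u))·ρ_L(Q,Q')` (the cut-off is `1` at both points; `π` dilates `ρ_L` by at most
`(1/(1−2r))/√(1−u)`, G53). [cite: ShenZhuZhu2022, §4.1] -/
theorem ext_shift_sub_le (F : GaugeConfig 3 L (Matrix.specialUnitaryGroup (Fin 2) ℂ) → ℝ) {Lf : ℝ} (hLf : 0 ≤ Lf)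
    (hlip : ∀ Q Q', |F Q' - F Q| ≤ Lf * Real.sqrt (torusRiemannDistSq (fundamentalLatticeRep 2) Q Q'))
    (Q Q' : GaugeConfig 3 L (Matrix.specialUnitaryGroup (Fin 2) ℂ)) (t : Edge 3 L × Fin 2 × Fin 2 × Bool → ℝ) {r u : ℝ} (hr : r ≤ 1 / 4) (hu : u < 1) :
    let coords : GaugeConfig 3 L (Matrix.specialUnitaryGroup (Fin 2) ℂ) → (Edge 3 L × Fin 2 × Fin 2 × Bool → ℝ) :=
      fun V q => (fun z : ℂ => if q.2.2.2 then z.im else z.re) ((fundamentalRep (Fin 2) (V q.1) : Matrix (Fin 2) (Fin 2) ℂ) q.2.1 q.2.2.1)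
    let rebuild : (Edge 3 L × Fin 2 × Fin 2 × Bool → ℝ) → Edge 3 L → Matrix (Fin 2) (Fin 2) ℂ :=
      fun x e => Matrix.of fun i j : Fin 2 => ((x (e, i, j, false) : ℝ) : ℂ) + ((x (e, i, j, true) : ℝ) : ℂ) * Complex.I
    let qP : Matrix (Fin 2) (Fin 2) ℂ → Matrix (Fin 2) (Fin 2) ℂ := fun M =>
      !![(M 0 0 + conj (M 1 1)) / 2, (M 0 1 - conj (M 1 0)) / 2; -conj ((M 0 1 - conj (M 1 0)) / 2), conj ((M 0 0 + conj (M 1 1)) / 2)]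
    let retr : (Edge 3 L × Fin 2 × Fin 2 × Bool → ℝ) → GaugeConfig 3 L (Matrix.specialUnitaryGroup (Fin 2) ℂ) := fun x e =>
      if h : hsForm 2 (qP (rebuild x e)) (qP (rebuild x e)) ≠ 0 then
        ⟨(Real.sqrt 2 / Real.sqrt (hsForm 2 (qP (rebuild x e)) (qP (rebuild x e)))) • qP (rebuild x e),
          normalize_quatProj_mem_specialUnitaryGroup_two (rebuild x e) h⟩
      else 1
    let cut : (Edge 3 L × Fin 2 × Fin 2 × Bool → ℝ) → ℝ := fun x =>
      ∏ e : Edge 3 L, Real.smoothTransition (8 * hsForm 2 (qP (rebuild x e)) (qP (rebuild x e)) - 1)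
    ‖t‖ ≤ r → (1 / (1 - 2 * r)) ^ 2 * torusRiemannDistSq (fundamentalLatticeRep 2) Q Q' ≤ 8 * u →
      |cut (coords Q' - t) * F (retr (coords Q' - t)) - cut (coords Q - t) * F (retr (coords Q - t))| ≤
        Lf * ((1 / (1 - 2 * r)) / Real.sqrt (1 - u)) * Real.sqrt (torusRiemannDistSq (fundamentalLatticeRep 2) Q Q') := by
  intro coords rebuild qP retr cut ht hsmall
  have hr0 : 0 ≤ r := le_trans (norm_nonneg _) ht
  have hx : ‖coords Q - t - coords Q‖ ≤ 1 / 4 := by rw [sub_sub_cancel_left, norm_neg]; exact ht.trans hr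
  have hx' : ‖coords Q' - t - coords Q'‖ ≤ 1 / 4 := by rw [sub_sub_cancel_left, norm_neg]; exact ht.trans hr
  have hcut : cut (coords Q - t) = 1 := (retr_near Q (coords Q - t) hx).2.1
  have hcut' : cut (coords Q' - t) = 1 := (retr_near Q' (coords Q' - t) hx').2.1
  have hT : torusRiemannDistSq (fundamentalLatticeRep 2) (retr (coords Q - t)) (retr (coords Q' - t)) ≤
      (1 / (1 - 2 * r)) ^ 2 / (1 - u) * torusRiemannDistSq (fundamentalLatticeRep 2) Q Q' :=
    torusRiemannDistSq_retr_shift_le Q Q' t hr hu ht hsmall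
  have h1u : 0 ≤ 1 - u := by linarith
  have hlam : 0 ≤ 1 / (1 - 2 * r) := div_nonneg zero_le_one (by linarith)
  rw [hcut, hcut', one_mul, one_mul]
  calc |F (retr (coords Q' - t)) - F (retr (coords Q - t))|
      ≤ Lf * Real.sqrt (torusRiemannDistSq (fundamentalLatticeRep 2) (retr (coords Q - t)) (retr (coords Q' - t))) := hlip _ _
    _ ≤ Lf * Real.sqrt ((1 / (1 - 2 * r)) ^ 2 / (1 - u) * torusRiemannDistSq (fundamentalLatticeRep 2) Q Q') :=
        mul_le_mul_of_nonneg_left (Real.sqrt_le_sqrt hT) hLf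
    _ = Lf * ((1 / (1 - 2 * r)) / Real.sqrt (1 - u)) * Real.sqrt (torusRiemannDistSq (fundamentalLatticeRep 2) Q Q') := by
        rw [Real.sqrt_mul (div_nonneg (sq_nonneg _) h1u), Real.sqrt_div (sq_nonneg _), Real.sqrt_sq hlam]; ring

/-- ★★ **Uniform local Lipschitz bound along common shifts**: for `r ≤ 1/4` and `η > 0` there is `δ > 0` such that for all `‖t‖_∞ ≤ r` and all `Q, Q'`
with `ρ_L(Q,Q') < δ`:  `|F̃(coords Q' − t) − F̃(coords Q − t)| ≤ (L_F/(1−2r) + η)·ρ_L(Q,Q')` (take `u = min(1/2, η/(L_F/(1−2r) + 1))`,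
`1/√(1−u) ≤ 1 + u`, `δ = √(8u)·(1 − 2r)`). [cite: ShenZhuZhu2022, §4.1] -/
theorem ext_shift_uniformLocalLipschitz (F : GaugeConfig 3 L (Matrix.specialUnitaryGroup (Fin 2) ℂ) → ℝ) {Lf : ℝ} (hLf : 0 ≤ Lf)
    (hlip : ∀ Q Q', |F Q' - F Q| ≤ Lf * Real.sqrt (torusRiemannDistSq (fundamentalLatticeRep 2) Q Q')) {r : ℝ} (hr : r ≤ 1 / 4)
    {η : ℝ} (hη : 0 < η) :
    let coords : GaugeConfig 3 L (Matrix.specialUnitaryGroup (Fin 2) ℂ) → (Edge 3 L × Fin 2 × Fin 2 × Bool → ℝ) :=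
      fun V q => (fun z : ℂ => if q.2.2.2 then z.im else z.re) ((fundamentalRep (Fin 2) (V q.1) : Matrix (Fin 2) (Fin 2) ℂ) q.2.1 q.2.2.1)
    let rebuild : (Edge 3 L × Fin 2 × Fin 2 × Bool → ℝ) → Edge 3 L → Matrix (Fin 2) (Fin 2) ℂ :=
      fun x e => Matrix.of fun i j : Fin 2 => ((x (e, i, j, false) : ℝ) : ℂ) + ((x (e, i, j, true) : ℝ) : ℂ) * Complex.I
    let qP : Matrix (Fin 2) (Fin 2) ℂ → Matrix (Fin 2) (Fin 2) ℂ := fun M =>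
      !![(M 0 0 + conj (M 1 1)) / 2, (M 0 1 - conj (M 1 0)) / 2; -conj ((M 0 1 - conj (M 1 0)) / 2), conj ((M 0 0 + conj (M 1 1)) / 2)]
    let retr : (Edge 3 L × Fin 2 × Fin 2 × Bool → ℝ) → GaugeConfig 3 L (Matrix.specialUnitaryGroup (Fin 2) ℂ) := fun x e =>
      if h : hsForm 2 (qP (rebuild x e)) (qP (rebuild x e)) ≠ 0 then
        ⟨(Real.sqrt 2 / Real.sqrt (hsForm 2 (qP (rebuild x e)) (qP (rebuild x e)))) • qP (rebuild x e),
          normalize_quatProj_mem_specialUnitaryGroup_two (rebuild x e) h⟩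
      else 1
    let cut : (Edge 3 L × Fin 2 × Fin 2 × Bool → ℝ) → ℝ := fun x =>
      ∏ e : Edge 3 L, Real.smoothTransition (8 * hsForm 2 (qP (rebuild x e)) (qP (rebuild x e)) - 1)
    ∃ δ > 0, ∀ t : Edge 3 L × Fin 2 × Fin 2 × Bool → ℝ, ‖t‖ ≤ r → ∀ Q Q' : GaugeConfig 3 L (Matrix.specialUnitaryGroup (Fin 2) ℂ),
      Real.sqrt (torusRiemannDistSq (fundamentalLatticeRep 2) Q Q') < δ →
        |cut (coords Q' - t) * F (retr (coords Q' - t)) - cut (coords Q - t) * F (retr (coords Q - t))| ≤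
          (Lf / (1 - 2 * r) + η) * Real.sqrt (torusRiemannDistSq (fundamentalLatticeRep 2) Q Q') := by
  intro coords rebuild qP retr cut
  set lam : ℝ := 1 / (1 - 2 * r) with hlamdef
  have h12 : 0 < 1 - 2 * r := by linarith
  have hlam : 0 < lam := div_pos one_pos h12
  set C : ℝ := Lf / (1 - 2 * r) with hCdef
  have hC : C = Lf * lam := div_eq_mul_one_div _ _
  have hC0 : 0 ≤ C := div_nonneg hLf h12.le
  set u : ℝ := min (1 / 2) (η / (C + 1)) with hudef
  have hu0 : 0 < u := lt_min (by norm_num) (div_pos hη (by linarith))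
  have hu2 : u ≤ 1 / 2 := min_le_left _ _
  have huη : u ≤ η / (C + 1) := min_le_right _ _
  have hu1 : u < 1 := by linarith
  refine ⟨Real.sqrt (8 * u) / lam, div_pos (Real.sqrt_pos.2 (by linarith)) hlam, fun t ht Q Q' hQ => ?_⟩
  set D : ℝ := Real.sqrt (torusRiemannDistSq (fundamentalLatticeRep 2) Q Q') with hDdef
  have hD0 : 0 ≤ D := Real.sqrt_nonneg _
  have hDsq : D ^ 2 = torusRiemannDistSq (fundamentalLatticeRep 2) Q Q' :=
    Real.sq_sqrt (by unfold torusRiemannDistSq; exact Finset.sum_nonneg fun _ _ => sq_nonneg _)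
  -- `λ²·ρ_L² ≤ 8u`
  have hsmall : (1 / (1 - 2 * r)) ^ 2 * torusRiemannDistSq (fundamentalLatticeRep 2) Q Q' ≤ 8 * u := by
    have h1 : lam * D < Real.sqrt (8 * u) := by rw [mul_comm]; exact (lt_div_iff₀ hlam).1 hQ
    have h2 : (lam * D) ^ 2 < Real.sqrt (8 * u) ^ 2 := pow_lt_pow_left₀ h1 (mul_nonneg hlam.le hD0) two_ne_zero
    rw [Real.sq_sqrt (by linarith), mul_pow, hDsq] at h2
    exact h2.le
  have hmain : |cut (coords Q' - t) * F (retr (coords Q' - t)) - cut (coords Q - t) * F (retr (coords Q - t))| ≤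
      Lf * (lam / Real.sqrt (1 - u)) * D := ext_shift_sub_le F hLf hlip Q Q' t hr hu1 ht hsmall
  refine hmain.trans (mul_le_mul_of_nonneg_right ?_ hD0)
  -- `L_F·λ/√(1−u) ≤ L_F·λ·(1+u) ≤ C + η`
  have h1u : 0 < 1 - u := by linarith
  have hK : 1 / Real.sqrt (1 - u) ≤ 1 + u := by
    rw [div_le_iff₀ (Real.sqrt_pos.2 h1u)]
    have hsq : (1 + u) * Real.sqrt (1 - u) = Real.sqrt ((1 + u) ^ 2 * (1 - u)) := by
      rw [Real.sqrt_mul (sq_nonneg _), Real.sqrt_sq (by linarith)]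
    rw [hsq]
    refine Real.one_le_sqrt.2 ?_
    have hpoly : 0 ≤ u * (1 - u - u ^ 2) := mul_nonneg hu0.le (by nlinarith)
    nlinarith
  have hCu : C * u ≤ η := by
    have h1 : C * u ≤ (C + 1) * u := by nlinarith
    have h2 : (C + 1) * u ≤ η := by
      have := (le_div_iff₀ (by linarith : (0 : ℝ) < C + 1)).1 huη
      linarith
    linarith
  calc Lf * (lam / Real.sqrt (1 - u)) = C * (1 / Real.sqrt (1 - u)) := by rw [hC]; ring
    _ ≤ C * (1 + u) := mul_le_mul_of_nonneg_left hK hC0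
    _ = C + C * u := by ring
    _ ≤ C + η := by linarith

/-! ## §2. A Lipschitz-type estimate for convolutions with a normed bump -/

/-- ★ If `|u(x − s) − u(x' − s)| ≤ B` for every `s` in the support ball of the normed bump `φ`, then `|(φ ⋆ u)(x) − (φ ⋆ u)(x')| ≤ B` (the normed bump is a
probability density). [folklore] -/
theorem normed_convolution_sub_le {X : Type*} [NormedAddCommGroup X] [NormedSpace ℝ X] [MeasurableSpace X] [BorelSpace X] [FiniteDimensional ℝ X]
    [HasContDiffBump X] (μ : Measure X) [μ.IsAddHaarMeasure] (φ : ContDiffBump (0 : X)) {u : X → ℝ} (hu : Continuous u) (x x' : X) {B : ℝ}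
    (hB : ∀ s ∈ Metric.ball (0 : X) φ.rOut, |u (x - s) - u (x' - s)| ≤ B) :
    |(φ.normed μ ⋆[ContinuousLinearMap.lsmul ℝ ℝ, μ] u) x - (φ.normed μ ⋆[ContinuousLinearMap.lsmul ℝ ℝ, μ] u) x'| ≤ B := by
  have hint : ∀ y : X, Integrable (fun s => φ.normed μ s * u (y - s)) μ := fun y =>
    (φ.continuous_normed.mul (hu.comp (continuous_const.sub continuous_id))).integrable_of_hasCompactSupport
      φ.hasCompactSupport_normed.mul_right
  rw [convolution_lsmul, convolution_lsmul]
  simp only [smul_eq_mul]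
  rw [← integral_sub (hint x) (hint x')]
  calc |∫ s, (φ.normed μ s * u (x - s) - φ.normed μ s * u (x' - s)) ∂μ| ≤ ∫ s, |φ.normed μ s * u (x - s) - φ.normed μ s * u (x' - s)| ∂μ :=
        abs_integral_le_integral_abs
    _ ≤ ∫ s, φ.normed μ s * B ∂μ := by
        refine integral_mono_of_nonneg (ae_of_all _ fun _ => abs_nonneg _) (φ.integrable_normed.mul_const B) (ae_of_all _ fun s => ?_)
        change |φ.normed μ s * u (x - s) - φ.normed μ s * u (x' - s)| ≤ φ.normed μ s * B
        rw [← mul_sub, abs_mul, abs_of_nonneg (φ.nonneg_normed s)]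
        by_cases hs : s ∈ Metric.ball (0 : X) φ.rOut
        · exact mul_le_mul_of_nonneg_left (hB s hs) (φ.nonneg_normed s)
        · have h0 : φ.normed μ s = 0 := by
            rw [← φ.support_normed_eq (μ := μ)] at hs
            exact Function.notMem_support.1 hs
          rw [h0, zero_mul, zero_mul]
    _ = B := by rw [integral_mul_const, φ.integral_normed, one_mul]

/-! ## §3. The contraction for every `ρ_L`-Lipschitz observable -/

/-- ★★ **The contraction up to the mollification error**: for `0 < r ≤ 1/4`,
`|∫F dκ_t(Q) − ∫F dκ_t(Q')| ≤ e^(−(1−12|β'|)t)·(L_F/(1−2r))·ρ_L(Q,Q') + 2·(12·L_F·√#E·r)`, by G44 applied to the `C^∞` mollification `g_r = φ_r ⋆ F̃`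
(`|g_r∘coords − F| ≤ 12·L_F·√#E·r`, `Lip_(ρ_L)(g_r∘coords) ≤ L_F/(1−2r)`). [cite: ShenZhuZhu2022, Theorem 4.2 (4.5)] -/
theorem wilson_riemannLipschitz_contraction_mollified (L : ℕ) [NeZero L]
    {F : GaugeConfig 3 L (Matrix.specialUnitaryGroup (Fin 2) ℂ) → ℝ} {Lf : ℝ} (hLf : 0 ≤ Lf)
    (hlip : ∀ Q Q', |F Q' - F Q| ≤ Lf * Real.sqrt (torusRiemannDistSq (fundamentalLatticeRep 2) Q Q'))
    (Q Q' : GaugeConfig 3 L (Matrix.specialUnitaryGroup (Fin 2) ℂ)) (t : ℝ≥0) (β' : ℝ) (hβ : |β'| < 1 / 12)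
    (κ : ℝ≥0 → Kernel (GaugeConfig 3 L (Matrix.specialUnitaryGroup (Fin 2) ℂ))
      (GaugeConfig 3 L (Matrix.specialUnitaryGroup (Fin 2) ℂ))) [∀ t, IsMarkovKernel (κ t)]
    (hreal : ∀ (t : ℝ≥0) (x : GaugeConfig 3 L (Matrix.specialUnitaryGroup (Fin 2) ℂ))
        (Ω : Type) [MeasurableSpace Ω] (P : Measure Ω) [IsProbabilityMeasure P]
        (W : ℝ≥0 → Ω → (Edge 3 L × NoiseIdx 2 → ℝ)) (hW : IsFlatBrownian W P)
        (U : ℝ≥0 → Ω → GaugeConfig 3 L (Matrix.specialUnitaryGroup (Fin 2) ℂ)),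
        (∀ ω, U 0 ω = x) →
        (latticeLangevinDynamics (fundamentalLatticeRep 2) β').IsSolution (fundamentalRep (Fin 2))
          hW.natFiltration P W U →
        κ t x = P.map (U t))
    {r : ℝ} (hr0 : 0 < r) (hr : r ≤ 1 / 4) :
    |∫ y, F y ∂(κ t Q) - ∫ y, F y ∂(κ t Q')| ≤
      Real.exp (-((1 - 12 * |β'|) * (t : ℝ))) * (Lf / (1 - 2 * r)) * Real.sqrt (torusRiemannDistSq (fundamentalLatticeRep 2) Q Q') +
        2 * (Lf * (12 * Real.sqrt (Fintype.card (Edge 3 L)) * r)) := by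
  let coords : GaugeConfig 3 L (Matrix.specialUnitaryGroup (Fin 2) ℂ) → (Edge 3 L × Fin 2 × Fin 2 × Bool → ℝ) :=
    fun V q => (fun z : ℂ => if q.2.2.2 then z.im else z.re) ((fundamentalRep (Fin 2) (V q.1) : Matrix (Fin 2) (Fin 2) ℂ) q.2.1 q.2.2.1)
  let rebuild : (Edge 3 L × Fin 2 × Fin 2 × Bool → ℝ) → Edge 3 L → Matrix (Fin 2) (Fin 2) ℂ :=
    fun x e => Matrix.of fun i j : Fin 2 => ((x (e, i, j, false) : ℝ) : ℂ) + ((x (e, i, j, true) : ℝ) : ℂ) * Complex.I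
  let qP : Matrix (Fin 2) (Fin 2) ℂ → Matrix (Fin 2) (Fin 2) ℂ := fun M =>
    !![(M 0 0 + conj (M 1 1)) / 2, (M 0 1 - conj (M 1 0)) / 2; -conj ((M 0 1 - conj (M 1 0)) / 2), conj ((M 0 0 + conj (M 1 1)) / 2)]
  let retr : (Edge 3 L × Fin 2 × Fin 2 × Bool → ℝ) → GaugeConfig 3 L (Matrix.specialUnitaryGroup (Fin 2) ℂ) := fun x e =>
    if h : hsForm 2 (qP (rebuild x e)) (qP (rebuild x e)) ≠ 0 then
      ⟨(Real.sqrt 2 / Real.sqrt (hsForm 2 (qP (rebuild x e)) (qP (rebuild x e)))) • qP (rebuild x e),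
        normalize_quatProj_mem_specialUnitaryGroup_two (rebuild x e) h⟩
    else 1
  let cut : (Edge 3 L × Fin 2 × Fin 2 × Bool → ℝ) → ℝ := fun x =>
    ∏ e : Edge 3 L, Real.smoothTransition (8 * hsForm 2 (qP (rebuild x e)) (qP (rebuild x e)) - 1)
  haveI := borelSpace_config L
  have hFc : Continuous F := continuous_of_riemannLipschitz hlip
  have hco : Continuous coords := continuous_coords (L := L)
  -- the extension and its mollification
  let Ft : (Edge 3 L × Fin 2 × Fin 2 × Bool → ℝ) → ℝ := fun x => cut x * F (retr x)
  have hFt : Continuous Ft := continuous_ext F hFc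
  let φ : ContDiffBump (0 : Edge 3 L × Fin 2 × Fin 2 × Bool → ℝ) := ⟨r / 2, r, half_pos hr0, half_lt_self hr0⟩
  let g : (Edge 3 L × Fin 2 × Fin 2 × Bool → ℝ) → ℝ := φ.normed volume ⋆[ContinuousLinearMap.lsmul ℝ ℝ, volume] Ft
  have hg : ContDiff ℝ 5 g := φ.hasCompactSupport_normed.contDiff_convolution_left _ φ.contDiff_normed hFt.locallyIntegrable
  -- (i) `|g(coords P) − F(P)| ≤ 12·L_F·√#E·r`
  have happrox : ∀ P : GaugeConfig 3 L (Matrix.specialUnitaryGroup (Fin 2) ℂ), |g (coords P) - F P| ≤ Lf * (12 * Real.sqrt (Fintype.card (Edge 3 L)) * r) := by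
    intro P
    have hP : Ft (coords P) = F P := (ext_coords F P).2
    have h1 : dist (g (coords P)) (Ft (coords P)) ≤ Lf * (12 * Real.sqrt (Fintype.card (Edge 3 L)) * r) := by
      refine φ.dist_normed_convolution_le hFt.aestronglyMeasurable fun x hx => ?_
      have hx' : ‖x - coords P‖ ≤ r := by
        have h := (Metric.mem_ball.1 hx).le
        rwa [dist_eq_norm] at h
      have hmod : |cut x * F (retr x) - F P| ≤ Lf * (12 * Real.sqrt (Fintype.card (Edge 3 L)) * r) := ext_modulus F hLf hlip P x hr hx'
      rw [Real.dist_eq, hP]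
      exact hmod
    rw [Real.dist_eq, hP] at h1
    exact h1
  -- (ii) `g∘coords` is `L_F/(1−2r)`-Lipschitz for `ρ_L`: locally by §1 and §2, globally by G51
  have hC : 0 ≤ Lf / (1 - 2 * r) := div_nonneg hLf (by linarith)
  have hglip : ∀ P P' : GaugeConfig 3 L (Matrix.specialUnitaryGroup (Fin 2) ℂ),
      |g (coords P') - g (coords P)| ≤ Lf / (1 - 2 * r) * Real.sqrt (torusRiemannDistSq (fundamentalLatticeRep 2) P P') := by
    refine fun P P' => riemannLipschitz_of_local (L := L) (h := fun P => g (coords P)) hC (fun Q₀ η hη => ?_) P P'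
    obtain ⟨δ, hδ, hloc⟩ : ∃ δ > 0, ∀ s : Edge 3 L × Fin 2 × Fin 2 × Bool → ℝ, ‖s‖ ≤ r →
        ∀ P P' : GaugeConfig 3 L (Matrix.specialUnitaryGroup (Fin 2) ℂ), Real.sqrt (torusRiemannDistSq (fundamentalLatticeRep 2) P P') < δ →
          |Ft (coords P' - s) - Ft (coords P - s)| ≤ (Lf / (1 - 2 * r) + η) * Real.sqrt (torusRiemannDistSq (fundamentalLatticeRep 2) P P') :=
      ext_shift_uniformLocalLipschitz F hLf hlip hr hη
    refine ⟨δ / 2, half_pos hδ, fun P P' h1 h2 => ?_⟩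
    have hPP' : Real.sqrt (torusRiemannDistSq (fundamentalLatticeRep 2) P P') < δ := by
      have htri := sqrt_torusRiemannDistSq_two_triangle P Q₀ P'
      rw [torusRiemannDistSq_two_comm P Q₀] at htri
      linarith
    have hconv := normed_convolution_sub_le volume φ hFt (coords P') (coords P)
      (B := (Lf / (1 - 2 * r) + η) * Real.sqrt (torusRiemannDistSq (fundamentalLatticeRep 2) P P'))
      (fun s hs => hloc s (mem_ball_zero_iff.1 hs).le P P' hPP')
    exact hconv
  -- (iii) G44 for the `C⁵` observable `g`
  have hcontr : |∫ y, g (coords y) ∂(κ t Q) - ∫ y, g (coords y) ∂(κ t Q')| ≤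
      Real.exp (-((1 - 12 * |β'|) * (t : ℝ))) * (Lf / (1 - 2 * r)) * Real.sqrt (torusRiemannDistSq (fundamentalLatticeRep 2) Q Q') :=
    wilson_riemannLipschitz_contraction_uniform L Q Q' t hC β' hβ κ hreal hg hglip
  -- (iv) `|∫F dκ_t(P) − ∫g∘coords dκ_t(P)| ≤ 12·L_F·√#E·r`
  have hint : ∀ P : GaugeConfig 3 L (Matrix.specialUnitaryGroup (Fin 2) ℂ),
      |∫ y, F y ∂(κ t P) - ∫ y, g (coords y) ∂(κ t P)| ≤ Lf * (12 * Real.sqrt (Fintype.card (Edge 3 L)) * r) := by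
    intro P
    have hFi : Integrable F (κ t P) := hFc.integrable_of_hasCompactSupport (HasCompactSupport.of_compactSpace F)
    have hgi : Integrable (fun y => g (coords y)) (κ t P) :=
      (hg.continuous.comp hco).integrable_of_hasCompactSupport (HasCompactSupport.of_compactSpace _)
    rw [← integral_sub hFi hgi]
    calc |∫ y, (F y - g (coords y)) ∂(κ t P)| ≤ ∫ y, |F y - g (coords y)| ∂(κ t P) := abs_integral_le_integral_abs
      _ ≤ ∫ _y, Lf * (12 * Real.sqrt (Fintype.card (Edge 3 L)) * r) ∂(κ t P) :=
          integral_mono_of_nonneg (ae_of_all _ fun _ => abs_nonneg _) (integrable_const _)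
            (ae_of_all _ fun y => (abs_sub_comm _ _).trans_le (happrox y))
      _ = Lf * (12 * Real.sqrt (Fintype.card (Edge 3 L)) * r) := by rw [integral_const, probReal_univ, one_smul]
  -- (v) assemble
  have h3a := abs_sub_le (∫ y, F y ∂(κ t Q)) (∫ y, g (coords y) ∂(κ t Q)) (∫ y, F y ∂(κ t Q'))
  have h3b := abs_sub_le (∫ y, g (coords y) ∂(κ t Q)) (∫ y, g (coords y) ∂(κ t Q')) (∫ y, F y ∂(κ t Q'))
  have h4 := hint Q
  have h5 : |∫ y, g (coords y) ∂(κ t Q') - ∫ y, F y ∂(κ t Q')| ≤ Lf * (12 * Real.sqrt (Fintype.card (Edge 3 L)) * r) := by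
    rw [abs_sub_comm]; exact hint Q'
  linarith

/-- ★★★ **Shen–Zhu–Zhu's Theorem 4.2 (4.5) in `W₁` form for EVERY `ρ_L`-Lipschitz observable, uniformly in the volume.**  For `|β'| < 1/12`, every `L`,
every Markov kernel family `κ` realising the `SU(2)` lattice Langevin dynamics on `(ℤ/L)³`, every `t ≥ 0`, all `Q, Q'` and every `F : SU(2)^E → ℝ` with
`|F(Q') − F(Q)| ≤ L_F·ρ_L(Q,Q')` (`L_F ≥ 0`, no smoothness assumed):
`|∫F dκ_t(Q) − ∫F dκ_t(Q')| ≤ e^(−(1 − 12|β'|)t)·L_F·ρ_L(Q,Q')`.  Equivalently `W₁,ρ_L(κ_t(Q,·), κ_t(Q',·)) ≤ e^(−(1−12|β'|)t)·ρ_L(Q,Q')`.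
[cite: ShenZhuZhu2022, Theorem 4.2 (4.5)] -/
theorem wilson_riemannLipschitz_contraction_allLipschitz (L : ℕ) [NeZero L]
    {F : GaugeConfig 3 L (Matrix.specialUnitaryGroup (Fin 2) ℂ) → ℝ} {Lf : ℝ} (hLf : 0 ≤ Lf)
    (hlip : ∀ Q Q', |F Q' - F Q| ≤ Lf * Real.sqrt (torusRiemannDistSq (fundamentalLatticeRep 2) Q Q'))
    (Q Q' : GaugeConfig 3 L (Matrix.specialUnitaryGroup (Fin 2) ℂ)) (t : ℝ≥0) (β' : ℝ) (hβ : |β'| < 1 / 12)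
    (κ : ℝ≥0 → Kernel (GaugeConfig 3 L (Matrix.specialUnitaryGroup (Fin 2) ℂ))
      (GaugeConfig 3 L (Matrix.specialUnitaryGroup (Fin 2) ℂ))) [∀ t, IsMarkovKernel (κ t)]
    (hreal : ∀ (t : ℝ≥0) (x : GaugeConfig 3 L (Matrix.specialUnitaryGroup (Fin 2) ℂ))
        (Ω : Type) [MeasurableSpace Ω] (P : Measure Ω) [IsProbabilityMeasure P]
        (W : ℝ≥0 → Ω → (Edge 3 L × NoiseIdx 2 → ℝ)) (hW : IsFlatBrownian W P)
        (U : ℝ≥0 → Ω → GaugeConfig 3 L (Matrix.specialUnitaryGroup (Fin 2) ℂ)),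
        (∀ ω, U 0 ω = x) →
        (latticeLangevinDynamics (fundamentalLatticeRep 2) β').IsSolution (fundamentalRep (Fin 2))
          hW.natFiltration P W U →
        κ t x = P.map (U t))
    :
    |∫ y, F y ∂(κ t Q) - ∫ y, F y ∂(κ t Q')| ≤
      Real.exp (-((1 - 12 * |β'|) * (t : ℝ))) * Lf * Real.sqrt (torusRiemannDistSq (fundamentalLatticeRep 2) Q Q') := by
  set D : ℝ := Real.sqrt (torusRiemannDistSq (fundamentalLatticeRep 2) Q Q') with hDdef
  set c : ℝ := Real.exp (-((1 - 12 * |β'|) * (t : ℝ))) with hcdef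
  have hD0 : 0 ≤ D := Real.sqrt_nonneg _
  have hc0 : 0 ≤ c := (Real.exp_pos _).le
  have hc1 : c ≤ 1 := by
    rw [hcdef, Real.exp_le_one_iff]
    have : 0 ≤ (1 - 12 * |β'|) * (t : ℝ) := mul_nonneg (by linarith) t.2
    linarith
  set E : ℝ := Real.sqrt (Fintype.card (Edge 3 L)) with hEdef
  have hE0 : 0 ≤ E := Real.sqrt_nonneg _
  refine le_of_forall_pos_le_add fun ε hε => ?_
  -- error budget: `r·M ≤ ε` with `M = 4·L_F·D + 24·L_F·E + 1`
  set M : ℝ := 4 * Lf * D + 24 * Lf * E + 1 with hMdef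
  have hM : 0 < M := by positivity
  set r : ℝ := min (1 / 4) (ε / M) with hrdef
  have hr0 : 0 < r := lt_min (by norm_num) (div_pos hε hM)
  have hr : r ≤ 1 / 4 := min_le_left _ _
  have hrM : r * M ≤ ε := by
    have := min_le_right (1 / 4 : ℝ) (ε / M)
    rwa [← hrdef, le_div_iff₀ hM] at this
  have hmain := wilson_riemannLipschitz_contraction_mollified L hLf hlip Q Q' t β' hβ κ hreal hr0 hr
  -- `1/(1−2r) ≤ 1 + 4r` for `r ≤ 1/4`
  have h12 : 0 < 1 - 2 * r := by linarith
  have hfrac : Lf / (1 - 2 * r) ≤ Lf * (1 + 4 * r) := by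
    rw [div_le_iff₀ h12]
    have : 1 ≤ (1 + 4 * r) * (1 - 2 * r) := by nlinarith
    nlinarith
  calc |∫ y, F y ∂(κ t Q) - ∫ y, F y ∂(κ t Q')| ≤ c * (Lf / (1 - 2 * r)) * D + 2 * (Lf * (12 * E * r)) := hmain
    _ ≤ c * (Lf * (1 + 4 * r)) * D + 2 * (Lf * (12 * E * r)) := by gcongr
    _ = c * Lf * D + r * (4 * (c * Lf * D) + 24 * Lf * E) := by ring
    _ ≤ c * Lf * D + r * M := by
        have h' : c * (Lf * D) ≤ 1 * (Lf * D) := mul_le_mul_of_nonneg_right hc1 (mul_nonneg hLf hD0)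
        have h'' : 4 * (c * Lf * D) + 24 * Lf * E ≤ M := by rw [hMdef]; nlinarith
        nlinarith [mul_le_mul_of_nonneg_left h'' hr0.le]
    _ ≤ c * Lf * D + ε := by linarith

end Summit.QuantumFields.YangMills.Theorems.ColdStartUniversality

end
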